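import Literature.MathematicalPhysics.QuantumLattice.InfVolFermionStateParticleHole
import Literature.MathematicalPhysics.QuantumLattice.InfVolFermionStateHubbardMeanEnergyBox
import Literature.MathematicalPhysics.QuantumLattice.TranslationInvariantFermionStatesAreEven
import Literature.MathematicalPhysics.QuantumLattice.HubbardTTPrimeKinematicRowsAllFillings
import Literature.MathematicalPhysics.QuantumLattice.TIGroundEnergyDensityResponse
import Literature.MathematicalPhysics.QuantumLattice.FermionHopAmplitudeBound
import Literature.MathematicalPhysics.QuantumLattice.DWaveOrderParameterInfiniteVolume
import HarnessLib

/-!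
# The particle–hole transform of the Hubbard MEAN ENERGY of a translation-invariant state:
# `e^{t,U}(ω ∘ α) = e^{t,U}(ω) + U (1 − ρ(ω))`; at `μ = U/2` (`t' = 0`) the mean-energy minimisers are
# particle–hole symmetric as a class

Topic `MathematicalPhysics/QuantumLattice`. Sequel of `InfVolFermionStateParticleHole` (the staggered particle–hole
automorphism `α`, `c_{xσ} ↦ ε_x c†_{xσ}`, and the state `ω ∘ α`; its «NOT here (next file): the image of the Hubbard
interaction» is this file, at the STATE level) and of `HubbardNNNHoppingEnergyDensityParticleHole` (the same symmetry
at the level of the ground-state energy density FUNCTION `e(n)`). Everything is PROVED; no definition, no named fact.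

* §1 `phAut_hubbardΦ_singleton` — `α(Φ{x}) = Φ{x} + U·(1 − n_{x↑} − n_{x↓})` (`α(n) = 1 − n`);
  `phAut_hubbardΦ_pair` — `α(Φ{x, x + e_i}) = Φ{x, x + e_i}` (nearest neighbours carry opposite staggers, and
  `c_x c†_y = −c†_y c_x` for distinct orbitals: the two halves of the bond term are exchanged).
* §2 `IsTranslationInvariant.hubbardEnergyDensity_particleHole` — for every translation-invariant state `ω` of the
  lattice fermions on `ℤ^d`, `d ≥ 1`: **`e^{t,U}(ω ∘ α) = e^{t,U}(ω) + U (1 − ρ(ω))`** (translation-invariant states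
  are even, `IsTranslationInvariant.isEven`, so `ω ∘ α` is again translation invariant and the mean energy is the sum of
  the term expectations through the origin, `IsTranslationInvariant.expect_hubbard_meanEnergyObs`). With
  `density_particleHole` (`ρ(ω ∘ α) = 2 − ρ(ω)`) this is the state-level form of Lieb's `P H P† = H − U N + U|Λ|`.
* §3 (`d = 2`, the `t–t'` pencil at `t' = 0`) `IsTranslationInvariant.meanEnergy_hubbardTTPrimeMu_particleHole` —
  `e_μ(ω ∘ α) = e_μ(ω) + (U − 2μ)(1 − ρ(ω))`; hence at the MIRROR point `μ = U/2` the `μ`-pencil mean energy is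
  particle–hole INVARIANT (`…_halfCoupling`), and **a translation-invariant mean-energy minimiser of `H^{t,0,U} − (U/2)N`
  is mapped to another one** (`IsMeanEnergyMinimiser.particleHole_halfCoupling`) — also in the sourced spelling at
  zero source (`…_sourced_halfCoupling`). Its density is `2 − ρ`; the even mixture `½(ω + ω ∘ α)` is a minimiser of
  density exactly `1` (`IsMeanEnergyMinimiser.mix_particleHole_halfCoupling`).

References: E. H. Lieb, PRL 62 (1989) 1201, proof of Thm 2 [LiebPRL1989]; H. Tasaki, *Physics and Mathematics of Quantum
Many-Body Systems* (2020) §9.3.3 [Tasaki2020]; F. H. L. Essler et al., *The One-Dimensional Hubbard Model* (2005) §2.2.4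
[EsslerEtAl2005]; O. Bratteli, A. Kishimoto, D. W. Robinson, CMP 64 (1978) 41, §3 [BratteliKishimotoRobinson1978].
-/

noncomputable section

namespace Literature.MathematicalPhysics.QuantumLattice

open Matrix Finset HubbardWave0 Literature.Probability.LatticeModels ThermodynamicLimit
open scoped ComplexOrder BigOperators

/-! ### §1 The particle–hole image of the local Hubbard terms -/

section Terms

variable {d : ℕ} (t U : ℝ)

/-- **`α(Φ{x}) = Φ{x} + U·(1 − n_{x↑} − n_{x↓})`**: `α(n_σ) = 1 − n_σ`, `(1 − n_↑)(1 − n_↓) = n_↑ n_↓ + (1 − n_↑ − n_↓)`.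
[cite: LiebPRL1989, proof of Theorem 2] -/
theorem phAut_hubbardΦ_singleton (x : Site d) :
    phAut {x} ((hubbardFermionInteraction d t U).Φ {x}) =
      (hubbardFermionInteraction d t U).Φ {x} +
        (U : ℂ) • (1 - nAt x (mem_singleton_self x) 0 - nAt x (mem_singleton_self x) 1) := by
  rw [hubbardFermionInteraction_apply_singleton, map_smul, map_mul, phAut_nAt, phAut_nAt, ← smul_add]
  congr 1
  noncomm_ring

/-- **`α(Φ{x, x + e_i}) = Φ{x, x + e_i}`**: the bond term is particle–hole invariant on `ℤ^d` (a bipartite lattice: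
`ε_{x+e_i} = −ε_x`, and `c_{xσ} c†_{yσ} = −c†_{yσ} c_{xσ}` for `x ≠ y`, so `α(c†_x c_y) = c†_y c_x`).
[cite: LiebPRL1989, proof of Theorem 2] [cite: EsslerEtAl2005, §2.2.4] -/
theorem phAut_hubbardΦ_pair (x : Site d) (i : Fin d) :
    phAut {x, x + unitVec i} ((hubbardFermionInteraction d t U).Φ {x, x + unitVec i}) =
      (hubbardFermionInteraction d t U).Φ {x, x + unitVec i} := by
  have hxy : x ≠ x + unitVec i := self_ne_add_unitVec x i
  have hx : x ∈ ({x, x + unitVec i} : Finset (Site d)) := mem_insert_self _ _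
  have hy : x + unitVec i ∈ ({x, x + unitVec i} : Finset (Site d)) := mem_insert_of_mem (mem_singleton_self _)
  have hε : ((((siteStagger x : ℤˣ) : ℤ) : ℂ)) * (((siteStagger (x + unitVec i) : ℤˣ) : ℤ) : ℂ) = -1 := by
    rw [show (unitVec i : Site d) = Pi.single i 1 from rfl, siteStagger_add_single_one, Units.val_neg,
      Int.cast_neg, mul_neg, ← Int.cast_mul, ← Units.val_mul, Int.units_mul_self, Units.val_one, Int.cast_one]
  have hε' : ((((siteStagger (x + unitVec i) : ℤˣ) : ℤ) : ℂ)) * (((siteStagger x : ℤˣ) : ℤ) : ℂ) = -1 := by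
    rw [mul_comm, hε]
  have hne : ∀ σ : Fin 2, orb (PolySite.pt x hx) σ ≠ orb (PolySite.pt (x + unitVec i) hy) σ := by
    intro σ h
    have h1 := (orb_eq_orb_iff.1 h).1
    exact hxy (toLex.injective (congrArg Subtype.val h1))
  have hswap : ∀ σ : Fin 2,
      cAt x hx σ * (cAt (x + unitVec i) hy σ)ᴴ = -((cAt (x + unitVec i) hy σ)ᴴ * cAt x hx σ) := fun σ => by
    rw [cAt, cAt, annihilation_conjTranspose, creation_mul_annihilation_eq_neg_of_ne (hne σ).symm, neg_neg]
  have hswap' : ∀ σ : Fin 2,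
      cAt (x + unitVec i) hy σ * (cAt x hx σ)ᴴ = -((cAt x hx σ)ᴴ * cAt (x + unitVec i) hy σ) := fun σ => by
    rw [cAt, cAt, annihilation_conjTranspose, creation_mul_annihilation_eq_neg_of_ne (hne σ), neg_neg]
  have hterm : ∀ σ : Fin 2,
      phAut {x, x + unitVec i} ((cAt x hx σ)ᴴ * cAt (x + unitVec i) hy σ + (cAt (x + unitVec i) hy σ)ᴴ * cAt x hx σ) =
        (cAt x hx σ)ᴴ * cAt (x + unitVec i) hy σ + (cAt (x + unitVec i) hy σ)ᴴ * cAt x hx σ := by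
    intro σ
    rw [map_add, map_mul, map_mul, phAut_cAt_conjTranspose, phAut_cAt, phAut_cAt_conjTranspose, phAut_cAt,
      smul_mul_smul, smul_mul_smul, hε, hε', hswap, hswap', neg_one_smul, neg_one_smul, neg_neg, neg_neg]
    exact add_comm _ _
  rw [hubbardFermionInteraction_apply_pair, map_smul, map_sum]
  simp_rw [hterm]

end Terms

/-! ### §2 The Hubbard energy density of the particle–hole transform -/

namespace InfVolFermionState

variable {d : ℕ} {ω : InfVolFermionState d} (t U : ℝ)

/-- The on-site term of the transform: `(ω ∘ α)(Φ{0}) = ω(Φ{0}) + U (1 − ω(n_{0↑}) − ω(n_{0↓}))`.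
[cite: LiebPRL1989, proof of Theorem 2] -/
theorem particleHole_expect_hubbardΦ_singleton (x : Site d) :
    ω.particleHole.expect {x} ((hubbardFermionInteraction d t U).Φ {x}) =
      ω.expect {x} ((hubbardFermionInteraction d t U).Φ {x}) +
        (U : ℂ) * (1 - ω.expect {x} (nAt x (mem_singleton_self x) 0) - ω.expect {x} (nAt x (mem_singleton_self x) 1)) := by
  rw [particleHole_expect, phAut_hubbardΦ_singleton, map_add, map_smul, map_sub, map_sub, ω.expect_one, smul_eq_mul]

/-- The bond term of the transform: `(ω ∘ α)(Φ{x, x + e_i}) = ω(Φ{x, x + e_i})`. [cite: LiebPRL1989, proof of Theorem 2] -/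
theorem particleHole_expect_hubbardΦ_pair (x : Site d) (i : Fin d) :
    ω.particleHole.expect {x, x + unitVec i} ((hubbardFermionInteraction d t U).Φ {x, x + unitVec i}) =
      ω.expect {x, x + unitVec i} ((hubbardFermionInteraction d t U).Φ {x, x + unitVec i}) := by
  rw [particleHole_expect, phAut_hubbardΦ_pair]

/-- **THE PARTICLE–HOLE TRANSFORM OF THE HUBBARD MEAN ENERGY** (`d ≥ 1`): for every translation-invariant state `ω`,
`e^{t,U}(ω ∘ α) = e^{t,U}(ω) + U (1 − ρ(ω))` — the state-level form of `P H(t,U) P† = H(t,U) − U N + U|Λ|` on a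
bipartite lattice. [cite: LiebPRL1989, proof of Theorem 2] [cite: BratteliKishimotoRobinson1978, §3 (mean energy functional)] -/
theorem IsTranslationInvariant.hubbardEnergyDensity_particleHole (hd : 0 < d) (hω : ω.IsTranslationInvariant) :
    ω.particleHole.hubbardEnergyDensity t U = ω.hubbardEnergyDensity t U + U * (1 - ω.density) := by
  have hω' : ω.particleHole.IsTranslationInvariant := hω.particleHole (hω.isEven hd)
  rw [InfVolFermionState.hubbardEnergyDensity, InfVolFermionState.hubbardEnergyDensity, meanEnergy, meanEnergy,
    hω'.expect_hubbard_meanEnergyObs, hω.expect_hubbard_meanEnergyObs, particleHole_expect_hubbardΦ_singleton]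
  simp_rw [particleHole_expect_hubbardΦ_pair]
  rw [density, densityAt, map_add]
  simp only [Complex.add_re, Complex.sub_re, Complex.mul_re, Complex.ofReal_re, Complex.ofReal_im, Complex.one_re,
    zero_mul, sub_zero]
  ring

end InfVolFermionState

/-! ### §3 `d = 2`, the `t–t'` pencil at `t' = 0`: invariance at the mirror point `μ = U/2` and the minimisers -/

namespace InfVolFermionState

variable {ω : InfVolFermionState 2} (t U μ : ℝ)

/-- `e^{t,0,U}(ω ∘ α) = e^{t,0,U}(ω) + U (1 − ρ(ω))` (the `t–t'` interaction at `t' = 0` is the nearest-neighbour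
Hubbard interaction, `hubbardTTPrimeFermionInteraction_tPrime_zero`). [cite: LiebPRL1989, proof of Theorem 2] -/
theorem IsTranslationInvariant.meanEnergy_hubbardTTPrime_zero_particleHole (hω : ω.IsTranslationInvariant) :
    ω.particleHole.meanEnergy (hubbardTTPrimeFermionInteraction t 0 U) 1 =
      ω.meanEnergy (hubbardTTPrimeFermionInteraction t 0 U) 1 + U * (1 - ω.density) := by
  rw [hubbardTTPrimeFermionInteraction_tPrime_zero]
  exact hω.hubbardEnergyDensity_particleHole t U two_pos

/-- **The `μ`-pencil**: `e_μ(ω ∘ α) = e_μ(ω) + (U − 2μ)(1 − ρ(ω))` for translation-invariant `ω` (`t' = 0`).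
[cite: LiebPRL1989, proof of Theorem 2] [cite: Tasaki2020, §9.3.3] -/
theorem IsTranslationInvariant.meanEnergy_hubbardTTPrimeMu_particleHole (hω : ω.IsTranslationInvariant) :
    ω.particleHole.meanEnergy (hubbardTTPrimeMuInteraction t 0 U μ) 1 =
      ω.meanEnergy (hubbardTTPrimeMuInteraction t 0 U μ) 1 + (U - 2 * μ) * (1 - ω.density) := by
  rw [meanEnergy_hubbardTTPrimeMu, meanEnergy_hubbardTTPrimeMu, hω.meanEnergy_hubbardTTPrime_zero_particleHole,
    density_particleHole]
  ring

/-- **At the mirror point `μ = U/2` the pencil mean energy is particle–hole invariant.** [cite: LiebPRL1989, proof of Theorem 2] -/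
theorem IsTranslationInvariant.meanEnergy_hubbardTTPrimeMu_particleHole_halfCoupling (hω : ω.IsTranslationInvariant) :
    ω.particleHole.meanEnergy (hubbardTTPrimeMuInteraction t 0 U (U / 2)) 1 =
      ω.meanEnergy (hubbardTTPrimeMuInteraction t 0 U (U / 2)) 1 := by
  rw [hω.meanEnergy_hubbardTTPrimeMu_particleHole]
  ring

/-- **Translation-invariant mean-energy minimisers of `H^{t,0,U} − (U/2)N` are mapped to minimisers by the
particle–hole transformation** (the class of Bratteli–Kishimoto–Robinson ground states at the mirror chemical potential is
particle–hole symmetric; the transform of a minimiser of density `ρ` has density `2 − ρ`).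
[cite: LiebPRL1989, proof of Theorem 2] [cite: BratteliKishimotoRobinson1978, Thm. 2 (condition 2)] -/
theorem IsMeanEnergyMinimiser.particleHole_halfCoupling
    (h : ω.IsMeanEnergyMinimiser (hubbardTTPrimeMuInteraction t 0 U (U / 2)) 1) :
    ω.particleHole.IsMeanEnergyMinimiser (hubbardTTPrimeMuInteraction t 0 U (U / 2)) 1 := by
  refine ⟨h.1.particleHole (h.1.isEven two_pos), fun ω' hω' => ?_⟩
  rw [h.1.meanEnergy_hubbardTTPrimeMu_particleHole_halfCoupling]
  have h2 := h.2 ω'.particleHole (hω'.particleHole (hω'.isEven two_pos))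
  rwa [hω'.meanEnergy_hubbardTTPrimeMu_particleHole_halfCoupling] at h2

/-- The same in the SOURCED spelling at zero source (`hubbardTTPrimeSourcedInteraction t 0 U (U/2) g 0 = H^{t,0,U} − (U/2)N`).
[cite: LiebPRL1989, proof of Theorem 2] -/
theorem IsMeanEnergyMinimiser.particleHole_sourced_halfCoupling (g : Site 2 → ℝ)
    (h : ω.IsMeanEnergyMinimiser (hubbardTTPrimeSourcedInteraction t 0 U (U / 2) g 0) 1) :
    ω.particleHole.IsMeanEnergyMinimiser (hubbardTTPrimeSourcedInteraction t 0 U (U / 2) g 0) 1 := by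
  rw [hubbardTTPrimeSourcedInteraction_zero_source] at h ⊢
  exact h.particleHole_halfCoupling t U

/-- **The even mixture `½(ω + ω ∘ α)` of a minimiser at `μ = U/2` is a minimiser of density exactly `1`.**
[cite: LiebPRL1989, proof of Theorem 2] [cite: BratteliKishimotoRobinson1978, Thm. 2 (condition 2)] -/
theorem IsMeanEnergyMinimiser.mix_particleHole_halfCoupling
    (h : ω.IsMeanEnergyMinimiser (hubbardTTPrimeMuInteraction t 0 U (U / 2)) 1) :
    (mix (1 / 2) (by norm_num) (by norm_num) ω ω.particleHole).IsMeanEnergyMinimiser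
        (hubbardTTPrimeMuInteraction t 0 U (U / 2)) 1 ∧
      (mix (1 / 2) (by norm_num) (by norm_num) ω ω.particleHole).density = 1 := by
  have hph := h.particleHole_halfCoupling t U
  refine ⟨⟨h.1.mix hph.1 _ _ _, fun ω' hω' => ?_⟩, ?_⟩
  · rw [meanEnergy_mix]
    have h1 := h.2 ω' hω'
    have h2 := hph.2 ω' hω'
    linarith
  · rw [density, densityAt, mix_expect, map_add, map_add]
    have hρ : ω.particleHole.density = 2 - ω.density := density_particleHole ω
    rw [density, densityAt, map_add, density, densityAt, map_add] at hρ
    simp only [Complex.add_re, Complex.mul_re, Complex.ofReal_re, Complex.ofReal_im, zero_mul, sub_zero] at hρ ⊢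
    linarith

end InfVolFermionState

end Literature.MathematicalPhysics.QuantumLattice

end
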